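import Mathlib
import Summits.KontsevichZagierPeriods.Zeta5Search.DenomLaw.ThresholdModelRho

/-!
# ζ(5) search — DENOM-LAW: the threshold model in ρ-coordinates, part 4: the counting form of DEEP and the mirror symmetry

Cell `pub-zeta5`, track DENOM-LAW (K1 typing order item (1), «ThresholdModel port»): denom-engine-d2 g11's kernel-checked scratch module
`denom-law/engine-d2/g11/lean/DeepCellLemmas.lean` (THRESHOLD-X3; theory-d1 g9/g10 SELECTION-LAW-PROOF Theorem S) filed VERBATIM in five parts
(≤ 400 lines each; split plan THRESHOLD-X3 §2 (a); docstrings added where the scratch file had none) by denom-prover-d1 g5.  Part 4 of 5.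
HONEST FRAMING: systematic search; MODEL/structure side — elementary integer inequalities of the level model; nothing about ζ(5); no γ; no irrationality claim; records in print UNMOVED.
The full mathematical header (setting, dictionary, what is proved) is the module docstring of part 1 (`ThresholdModelRho.lean`).
-/

namespace Summit.KontsevichZagierPeriods.Zeta5Search.DenomLaw.ThresholdModel.Rho

section CountForm
variable (p R0 : ℤ) (r : Fin 7 → ℤ)

/-- `a = #{j : b_j ≥ mp} = #{j : ρ_j ≤ R₀ − p}`. -/
def aCount : ℤ := countLe r (R0 - p)
/-- `λ₁ = #{k > 1 : pair digit (1,k) = m−1} = #{k > 1 : ρ₁ + ρ_k < 2p}` (blocks indexed from 1 in the notes, from 0 here). -/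
def lam0 : ℤ := indic (r 0 + r 1 < 2 * p) + indic (r 0 + r 2 < 2 * p) + indic (r 0 + r 3 < 2 * p) +
  indic (r 0 + r 4 < 2 * p) + indic (r 0 + r 5 < 2 * p) + indic (r 0 + r 6 < 2 * p)
/-- `λ₂ = #{k > 2 : ρ₂ + ρ_k < 2p}`. -/
def lam1 : ℤ := indic (r 1 + r 2 < 2 * p) + indic (r 1 + r 3 < 2 * p) + indic (r 1 + r 4 < 2 * p) +
  indic (r 1 + r 5 < 2 * p) + indic (r 1 + r 6 < 2 * p)
/-- `λ₃ = #{k > 3 : ρ₃ + ρ_k < 2p}`. -/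
def lam2 : ℤ := indic (r 2 + r 3 < 2 * p) + indic (r 2 + r 4 < 2 * p) + indic (r 2 + r 5 < 2 * p) +
  indic (r 2 + r 6 < 2 * p)
/-- `λ₄`. -/
def lam3 : ℤ := indic (r 3 + r 4 < 2 * p) + indic (r 3 + r 5 < 2 * p) + indic (r 3 + r 6 < 2 * p)
/-- `λ₅`. -/
def lam4 : ℤ := indic (r 4 + r 5 < 2 * p) + indic (r 4 + r 6 < 2 * p)
/-- `λ₆`. -/
def lam5 : ℤ := indic (r 5 + r 6 < 2 * p)

/-- the DEEP condition exactly as enumerated by engine-d2 g9/g10 (`DEEP = {0: (3,1), 1: (2,1), 2: (2,)}`, componentwise on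
the zero-padded λ vector; for sorted `b` the λ vector is non-increasing, so dropping its zero entries changes nothing). -/
def IsDeepCount : Prop :=
  (aCount p R0 r = 0 ∧ lam0 p r ≤ 3 ∧ lam1 p r ≤ 1 ∧ lam2 p r = 0 ∧ lam3 p r = 0 ∧ lam4 p r = 0 ∧ lam5 p r = 0) ∨
  (aCount p R0 r = 1 ∧ lam0 p r ≤ 2 ∧ lam1 p r ≤ 1 ∧ lam2 p r = 0 ∧ lam3 p r = 0 ∧ lam4 p r = 0 ∧ lam5 p r = 0) ∨
  (aCount p R0 r = 2 ∧ lam0 p r ≤ 2 ∧ lam1 p r = 0 ∧ lam2 p r = 0 ∧ lam3 p r = 0 ∧ lam4 p r = 0 ∧ lam5 p r = 0)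

end CountForm

section CountBridge
variable {p R0 : ℤ} {r : Fin 7 → ℤ}

/-- sorted blocks: if `r k ≤ T` then at least `k+1` blocks are `≤ T`. -/
theorem countLe_ge (hr : Monotone r) (k : Fin 7) {T : ℤ} (h : r k ≤ T) : (k : ℤ) + 1 ≤ countLe r T := by
  unfold countLe
  calc ((k : ℕ) : ℤ) + 1 = ∑ j : Fin 7, indic ((j : ℕ) < (k : ℕ) + 1) := by
        have := sum_indic_lt_nat ((k : ℕ) + 1) (by omega)
        push_cast at this ⊢
        linarith
    _ ≤ ∑ j : Fin 7, indic (r j ≤ T) := by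
        apply Finset.sum_le_sum
        intro j _
        apply indic_mono
        intro hj
        have : r j ≤ r k := hr (Fin.le_iff_val_le_val.2 (by omega))
        linarith

/-- `a = 0` iff `R₀ − p < ρ₁`. -/
theorem aCount_eq_zero_iff (hr : Monotone r) : aCount p R0 r = 0 ↔ R0 - p < r 0 := by
  unfold aCount
  constructor
  · intro h
    by_contra h0
    have := countLe_ge hr 0 (T := R0 - p) (not_lt.1 h0)
    simp at this
    linarith
  · intro h
    have := countLe_le hr 0 h
    have h' := Finset.sum_nonneg fun j (_ : j ∈ (Finset.univ : Finset (Fin 7))) => indic_nonneg (r j ≤ R0 - p)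
    unfold countLe at *
    simp at this
    linarith

/-- `a = 1` iff `ρ₁ ≤ R₀ − p < ρ₂`. -/
theorem aCount_eq_one_iff (hr : Monotone r) : aCount p R0 r = 1 ↔ r 0 ≤ R0 - p ∧ R0 - p < r 1 := by
  unfold aCount
  constructor
  · intro h
    constructor
    · by_contra h0
      have := countLe_le hr 0 (T := R0 - p) (not_le.1 h0)
      simp at this
      linarith
    · by_contra h1
      have := countLe_ge hr 1 (T := R0 - p) (not_lt.1 h1)
      simp at this
      linarith
  · rintro ⟨h0, h1⟩
    have a := countLe_ge hr 0 h0
    have b := countLe_le hr 1 h1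
    simp at a b
    linarith

/-- `a = 2` iff `ρ₂ ≤ R₀ − p < ρ₃`. -/
theorem aCount_eq_two_iff (hr : Monotone r) : aCount p R0 r = 2 ↔ r 1 ≤ R0 - p ∧ R0 - p < r 2 := by
  unfold aCount
  constructor
  · intro h
    constructor
    · by_contra h0
      have := countLe_le hr 1 (T := R0 - p) (not_le.1 h0)
      simp at this
      linarith
    · by_contra h1
      have := countLe_ge hr 2 (T := R0 - p) (not_lt.1 h1)
      simp at this
      linarith
  · rintro ⟨h0, h1⟩
    have a := countLe_ge hr 1 h0
    have b := countLe_le hr 2 h1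
    simp at a b
    linarith

/-- `λ₁ ≤ 3` iff `ρ₁ + ρ₅ ≥ 2p`. -/
theorem lam0_le_three_iff (hr : Monotone r) : lam0 p r ≤ 3 ↔ 2 * p ≤ r 0 + r 4 := by
  have h12 : r 1 ≤ r 2 := hr (by decide)
  have h23 : r 2 ≤ r 3 := hr (by decide)
  have h34 : r 3 ≤ r 4 := hr (by decide)
  have h45 : r 4 ≤ r 5 := hr (by decide)
  have h56 : r 5 ≤ r 6 := hr (by decide)
  have i1 := indic_le_one (r 0 + r 1 < 2 * p)
  have i2 := indic_le_one (r 0 + r 2 < 2 * p)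
  have i3 := indic_le_one (r 0 + r 3 < 2 * p)
  unfold lam0
  constructor
  · intro h
    by_contra hc
    rw [indic_pos (by omega : r 0 + r 1 < 2 * p), indic_pos (by omega : r 0 + r 2 < 2 * p),
      indic_pos (by omega : r 0 + r 3 < 2 * p), indic_pos (by omega : r 0 + r 4 < 2 * p)] at h
    have := indic_nonneg (r 0 + r 5 < 2 * p)
    have := indic_nonneg (r 0 + r 6 < 2 * p)
    linarith
  · intro h
    rw [indic_neg (by omega : ¬ r 0 + r 4 < 2 * p), indic_neg (by omega : ¬ r 0 + r 5 < 2 * p),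
      indic_neg (by omega : ¬ r 0 + r 6 < 2 * p)]
    linarith

/-- `λ₁ ≤ 2` iff `ρ₁ + ρ₄ ≥ 2p`. -/
theorem lam0_le_two_iff (hr : Monotone r) : lam0 p r ≤ 2 ↔ 2 * p ≤ r 0 + r 3 := by
  have h12 : r 1 ≤ r 2 := hr (by decide)
  have h23 : r 2 ≤ r 3 := hr (by decide)
  have h34 : r 3 ≤ r 4 := hr (by decide)
  have h45 : r 4 ≤ r 5 := hr (by decide)
  have h56 : r 5 ≤ r 6 := hr (by decide)
  have i1 := indic_le_one (r 0 + r 1 < 2 * p)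
  have i2 := indic_le_one (r 0 + r 2 < 2 * p)
  unfold lam0
  constructor
  · intro h
    by_contra hc
    rw [indic_pos (by omega : r 0 + r 1 < 2 * p), indic_pos (by omega : r 0 + r 2 < 2 * p),
      indic_pos (by omega : r 0 + r 3 < 2 * p)] at h
    have := indic_nonneg (r 0 + r 4 < 2 * p)
    have := indic_nonneg (r 0 + r 5 < 2 * p)
    have := indic_nonneg (r 0 + r 6 < 2 * p)
    linarith
  · intro h
    rw [indic_neg (by omega : ¬ r 0 + r 3 < 2 * p), indic_neg (by omega : ¬ r 0 + r 4 < 2 * p),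
      indic_neg (by omega : ¬ r 0 + r 5 < 2 * p), indic_neg (by omega : ¬ r 0 + r 6 < 2 * p)]
    linarith

/-- `λ₂ ≤ 1` iff `ρ₂ + ρ₄ ≥ 2p`. -/
theorem lam1_le_one_iff (hr : Monotone r) : lam1 p r ≤ 1 ↔ 2 * p ≤ r 1 + r 3 := by
  have h23 : r 2 ≤ r 3 := hr (by decide)
  have h34 : r 3 ≤ r 4 := hr (by decide)
  have h45 : r 4 ≤ r 5 := hr (by decide)
  have h56 : r 5 ≤ r 6 := hr (by decide)
  have i1 := indic_le_one (r 1 + r 2 < 2 * p)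
  unfold lam1
  constructor
  · intro h
    by_contra hc
    rw [indic_pos (by omega : r 1 + r 2 < 2 * p), indic_pos (by omega : r 1 + r 3 < 2 * p)] at h
    have := indic_nonneg (r 1 + r 4 < 2 * p)
    have := indic_nonneg (r 1 + r 5 < 2 * p)
    have := indic_nonneg (r 1 + r 6 < 2 * p)
    linarith
  · intro h
    rw [indic_neg (by omega : ¬ r 1 + r 3 < 2 * p), indic_neg (by omega : ¬ r 1 + r 4 < 2 * p),
      indic_neg (by omega : ¬ r 1 + r 5 < 2 * p), indic_neg (by omega : ¬ r 1 + r 6 < 2 * p)]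
    linarith

/-- `λ₂ = 0` iff `ρ₂ + ρ₃ ≥ 2p`. -/
theorem lam1_eq_zero_iff (hr : Monotone r) : lam1 p r = 0 ↔ 2 * p ≤ r 1 + r 2 := by
  have h23 : r 2 ≤ r 3 := hr (by decide)
  have h34 : r 3 ≤ r 4 := hr (by decide)
  have h45 : r 4 ≤ r 5 := hr (by decide)
  have h56 : r 5 ≤ r 6 := hr (by decide)
  unfold lam1
  constructor
  · intro h
    by_contra hc
    rw [indic_pos (by omega : r 1 + r 2 < 2 * p)] at h
    have := indic_nonneg (r 1 + r 3 < 2 * p)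
    have := indic_nonneg (r 1 + r 4 < 2 * p)
    have := indic_nonneg (r 1 + r 5 < 2 * p)
    have := indic_nonneg (r 1 + r 6 < 2 * p)
    linarith
  · intro h
    rw [indic_neg (by omega : ¬ r 1 + r 2 < 2 * p), indic_neg (by omega : ¬ r 1 + r 3 < 2 * p),
      indic_neg (by omega : ¬ r 1 + r 4 < 2 * p), indic_neg (by omega : ¬ r 1 + r 5 < 2 * p),
      indic_neg (by omega : ¬ r 1 + r 6 < 2 * p)]
    simp

/-- `λ₃ = 0` iff `ρ₃ + ρ₄ ≥ 2p`. -/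
theorem lam2_eq_zero_iff (hr : Monotone r) : lam2 p r = 0 ↔ 2 * p ≤ r 2 + r 3 := by
  have h34 : r 3 ≤ r 4 := hr (by decide)
  have h45 : r 4 ≤ r 5 := hr (by decide)
  have h56 : r 5 ≤ r 6 := hr (by decide)
  unfold lam2
  constructor
  · intro h
    by_contra hc
    rw [indic_pos (by omega : r 2 + r 3 < 2 * p)] at h
    have := indic_nonneg (r 2 + r 4 < 2 * p)
    have := indic_nonneg (r 2 + r 5 < 2 * p)
    have := indic_nonneg (r 2 + r 6 < 2 * p)
    linarith
  · intro h
    rw [indic_neg (by omega : ¬ r 2 + r 3 < 2 * p), indic_neg (by omega : ¬ r 2 + r 4 < 2 * p),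
      indic_neg (by omega : ¬ r 2 + r 5 < 2 * p), indic_neg (by omega : ¬ r 2 + r 6 < 2 * p)]
    simp

/-- the higher λ's vanish as soon as `ρ₃ + ρ₄ ≥ 2p` (sortedness). -/
theorem lam345_eq_zero (hr : Monotone r) (h : 2 * p ≤ r 2 + r 3) : lam3 p r = 0 ∧ lam4 p r = 0 ∧ lam5 p r = 0 := by
  have h23 : r 2 ≤ r 3 := hr (by decide)
  have h34 : r 3 ≤ r 4 := hr (by decide)
  have h45 : r 4 ≤ r 5 := hr (by decide)
  have h56 : r 5 ≤ r 6 := hr (by decide)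
  unfold lam3 lam4 lam5
  rw [indic_neg (by omega : ¬ r 3 + r 4 < 2 * p), indic_neg (by omega : ¬ r 3 + r 5 < 2 * p),
    indic_neg (by omega : ¬ r 3 + r 6 < 2 * p), indic_neg (by omega : ¬ r 4 + r 5 < 2 * p),
    indic_neg (by omega : ¬ r 4 + r 6 < 2 * p), indic_neg (by omega : ¬ r 5 + r 6 < 2 * p)]
  simp

/-- **the counting form of DEEP is equivalent to the inequality form used in `DeepCell`** (for sorted ρ). -/
theorem isDeepCount_iff (hr : Monotone r) : IsDeepCount p R0 r ↔
    ((R0 - p < r 0 ∧ 2 * p ≤ r 0 + r 4 ∧ 2 * p ≤ r 1 + r 3 ∧ 2 * p ≤ r 2 + r 3) ∨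
     (r 0 ≤ R0 - p ∧ R0 - p < r 1 ∧ 2 * p ≤ r 0 + r 3 ∧ 2 * p ≤ r 1 + r 3 ∧ 2 * p ≤ r 2 + r 3) ∨
     (r 1 ≤ R0 - p ∧ R0 - p < r 2 ∧ 2 * p ≤ r 0 + r 3 ∧ 2 * p ≤ r 1 + r 2)) := by
  have h12 : r 1 ≤ r 2 := hr (by decide)
  have h23 : r 2 ≤ r 3 := hr (by decide)
  have A0 := aCount_eq_zero_iff (p := p) (R0 := R0) hr
  have A1 := aCount_eq_one_iff (p := p) (R0 := R0) hr
  have A2 := aCount_eq_two_iff (p := p) (R0 := R0) hr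
  have L03 := lam0_le_three_iff (p := p) hr
  have L02 := lam0_le_two_iff (p := p) hr
  have L11 := lam1_le_one_iff (p := p) hr
  have L10 := lam1_eq_zero_iff (p := p) hr
  have L20 := lam2_eq_zero_iff (p := p) hr
  unfold IsDeepCount
  constructor
  · rintro (⟨ha, l0, l1, l2, -, -, -⟩ | ⟨ha, l0, l1, l2, -, -, -⟩ | ⟨ha, l0, l1, -, -, -, -⟩)
    · exact Or.inl ⟨A0.1 ha, L03.1 l0, L11.1 l1, L20.1 l2⟩
    · exact Or.inr (Or.inl ⟨(A1.1 ha).1, (A1.1 ha).2, L02.1 l0, L11.1 l1, L20.1 l2⟩)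
    · refine Or.inr (Or.inr ⟨(A2.1 ha).1, (A2.1 ha).2, L02.1 l0, L10.1 l1⟩)
  · rintro (⟨ha, l0, l1, l2⟩ | ⟨ha, ha', l0, l1, l2⟩ | ⟨ha, ha', l0, l1⟩)
    · have z := lam345_eq_zero (p := p) hr l2
      exact Or.inl ⟨A0.2 ha, L03.2 l0, L11.2 l1, L20.2 l2, z.1, z.2.1, z.2.2⟩
    · have z := lam345_eq_zero (p := p) hr l2
      exact Or.inr (Or.inl ⟨A1.2 ⟨ha, ha'⟩, L02.2 l0, L11.2 l1, L20.2 l2, z.1, z.2.1, z.2.2⟩)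
    · have l2 : 2 * p ≤ r 2 + r 3 := by linarith
      have z := lam345_eq_zero (p := p) hr l2
      exact Or.inr (Or.inr ⟨A2.2 ⟨ha, ha'⟩, L02.2 l0, L10.2 l1, L20.2 l2, z.1, z.2.1, z.2.2⟩)

/-- constructor of `DeepCell` from the digit conditions and the ORIGINAL counting form of deep. -/
theorem DeepCell.of_count (hp : p % 2 = 1) (hp3 : 3 ≤ p) (hr : Monotone r) (hpar : ∀ j, (r j - R0) % 2 = 1)
    (hlo : ∀ j, R0 - 3 * p + 2 ≤ r j) (hhi : ∀ j, r j ≤ R0 + p) (hplo : 0 ≤ r 0 + r 1) (hphi : r 5 + r 6 ≤ 4 * p - 2)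
    (hdeep : IsDeepCount p R0 r) : DeepCell p R0 r :=
  ⟨hp, hp3, hr, hpar, hlo, hhi, hplo, hphi, (isDeepCount_iff hr).1 hdeep⟩

/-- … and a deep cell satisfies the counting form. -/
theorem DeepCell.isDeepCount (h : DeepCell p R0 r) : IsDeepCount p R0 r := (isDeepCount_iff h.mono).2 h.deep

end CountBridge

section Mirror

/-! ## Mirror symmetry `u ↦ −u` of the defect (S3c: dominant sets are symmetric off the centre class) -/

/-- `δ(−u) = δ(u)` (`L ↔ R`, `n₊ ↔ n₋`). -/
theorem delta_neg (p R0 : ℤ) (r : Fin 7 → ℤ) (u : ℤ) : delta p R0 r (-u) = delta p R0 r u := by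
  unfold delta L R np nm
  rw [show -u + p = p - u by ring, show p - -u = u + p by ring]
  have e1 : indic (2 * p - R0 ≤ -u) = indic (u ≤ R0 - 2 * p) := indic_congr (by constructor <;> intro h <;> linarith)
  have e2 : indic (-u ≤ R0 - 2 * p) = indic (2 * p - R0 ≤ u) := indic_congr (by constructor <;> intro h <;> linarith)
  rw [e1, e2]
  ring

end Mirror

end Summit.KontsevichZagierPeriods.Zeta5Search.DenomLaw.ThresholdModel.Rho
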